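import Literature.Algebra.EuclideanDomain.EuclideanOrderTypeProduct
import Literature.Algebra.EuclideanDomain.SmallestAlgorithmFiniteValued
import HarnessLib

/-!
# The smallest algorithm of a product of two small Euclidean rings: `θ(x, y) = θ(x) + θ(y) − 1`, `θ(x, 0) = ω + (θ(x) − 1)`,
# Euclidean order type `ω + ω` (Clark 2015 Thm. 22, Thm. 27 (a), Prop. 28; Samuel 1971 §3 Remark (2))

Topic `Literature/Algebra/EuclideanDomain`, namespace `Literature.Algebra.EuclideanDomain`.  THEOREMS ONLY (no `def`, no
instance, no named fact), all proved, in the vocabulary of `TransfiniteSmallestAlgorithm.lean` (`samuelSet R α = A_α`,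
`samuelRank = θ`; Euclidean order type `e(R) = ⨆ z, ((θ z − 1) + 1)` as in `EuclideanOrderTypeIndecomposable.lean`).
This file GENERALISES `IntProdIntSmallestAlgorithm.lean` (the case `ℤ × ℤ`, where `θ_ℤ = ` number of binary digits) to
any two factors.

## Source (read at the page)

P. L. Clark, *A note on Euclidean order types*, Order **32** (2015) 157–178 [Clark2015EuclideanOrderTypes] (materialised
`paper:arxiv-1208.0977`, arXiv numbering), VERBATIM.  §2.8 Theorem 22 (Product Theorem) (b): «`e(R₁) + … + e(R_n) ≤
e(∏ Rᵢ) ≤ e(R₁) ⊕ … ⊕ e(R_n)`».  §2.9: «We say a Euclidean ring `R ≅ ∏_{i=1}^r Rᵢ × A(R)` is small if `e(Rᵢ) = ω` for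
all `i`; otherwise we say `R` is large.  Theorem 27. a) Let `R ≅ ∏_{i=1}^r Rᵢ × A` be a small Euclidean ring.  Then
`e(R) = rω + ℓ(A)` … Proof. a) … `rω + ℓ(A) = e₁(R) + … + e_r(R) + e(A) ≤ e(R) ≤ ⊕ e(Rᵢ) ⊕ ℓ(A) = rω + ℓ(A)`.»
«Proposition 28. ([Samuel71]) Let `R` be a Euclidean domain such that `R/(a)` is a finite ring for all `a ∈ R•`. Then `R`
is small.»  (For `ℤ × ℤ` and the unavoidability of transfinite values: Samuel 1971, §3 Remark (2), pp. 286–287.)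

## Setting and what is formalised

«Small» is taken stage-wise: `R` is SMALL when its finite stages exhaust it (`∀ x, ∃ n, x ∈ A_n(R)`, i.e. `θ` is finite
valued — Samuel's Prop. 15 / Clark's Prop. 28 give this for finite residue rings, `SmallestAlgorithmFiniteValued.lean`) and
UNBOUNDED when no finite stage exhausts it (`∀ n, ∃ x ∉ A_n(R)`; together: `e(R) = ω`).
* §1 for ALL commutative `R`, `S`: `x ∈ A_{i+1}(R)`, `y ∈ A_{j+1}(S)`, `x, y ≠ 0 ⟹ (x, y) ∈ A_{i+j+1}(R × S)`
  (`Prod.mk_mem_samuelSet_natCast_add` — the finite part of the upper bound `e(R × S) ≤ e(R) ⊕ e(S)`), and, when no finite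
  stage exhausts `S`, `x ∉ A_i(R)`, `y ∉ A_j(S) ⟹ (x, y) ∉ A_{i+j}(R × S)` (`Prod.mk_not_mem_samuelSet_natCast_add`, by
  testing the class of `(a₁, 0)`, `a₁` a «bad class» of `x`); hence **`θ(x, y) = θ(x) + θ(y) − 1`** for finite
  `θ(x), θ(y) ≥ 1` (**`Prod.samuelRank_mk_of_samuelRank_eq`**; in Clark's normalisation `φ(x, y) = φ(x) + φ(y)`).
* §2 on the axis, `S` small and unbounded: **`θ(x, 0) = ω + (θ(x) − 1)`** (**`Prod.samuelRank_mk_zero_of_samuelRank_eq`**;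
  Clark: `φ(x, 0) = e(S) + φ(x) = ω + φ(x)`), and symmetrically `θ(0, y)`.
* §3 both factors small and unbounded: every value of `θ` on `R × S` is `< ω + ω`, **`A_α(R × S) = R × S ⟺ ω + ω ≤ α`**
  (`Prod.samuelSet_eq_univ_iff_of_small`), **`e(R × S) = ω + ω`** (**`Prod.iSup_samuelRank_eq_of_small`** — Thm. 27 (a)
  with `r = 2`, `A = 0`: «`e(R) = rω`»; the lower bound alone is `EuclideanOrderTypeProduct.lean`), and every algorithm on
  `R × S` with values in a well-ordered `W` forces `ω + ω ≤ type W` (`Prod.omega0_add_omega0_le_type_of_small`).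
* §4 (Prop. 28 + Thm. 27 (a)) two Mathlib `EuclideanDomain`s, not fields, with finite residue rings: `e(R × S) = ω + ω`
  (**`iSup_samuelRank_prod_eq_of_finite_quotients`**) — `ℤ × ℤ` (`IntProdIntSmallestAlgorithm.lean`), `ℤ × ℤ[i]`,
  `𝔽_q[X] × ℤ`, ….
-- TODO(general form): `r` factors and an Artinian part `A` (`e = rω + ℓ(A)`), and large factors (Hessenberg sum).

## Mathlib / tree search

Mathlib: ordinal arithmetic as in `IntProdIntSmallestAlgorithm.lean`.  Tree: `IntProdIntSmallestAlgorithm.lean` (`ℤ × ℤ`;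
`fst_mem_samuelSet`, `snd_mem_samuelSet`, `forall_exists_mem_samuelSet_lt_of_mk_zero_mem`, `samuelRank_map_ringEquiv`),
`EuclideanOrderTypeProduct.lean` (`e(R) + e(S) ≤ e(R × S)`, `omega0_le_iSup_samuelRank_of_euclideanDomain`),
`SmallestAlgorithmFiniteValued.lean` (`iUnion_samuelSet_natCast_eq_univ_of_finite_quotients`),
`TransfiniteSmallestAlgorithm.lean` (`mem_samuelSet_of_mul_mem`, `samuelRank_le_typein`).
-/

namespace Literature.Algebra.EuclideanDomain

universe u

open Ordinal

section Product

variable {R S : Type u} [CommRing R] [CommRing S]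

/-- Divisibility in a product ring is coordinatewise. [folklore] -/
private theorem prodMk_dvd_iff {x₁ y₁ : R} {x₂ y₂ : S} : ((x₁, x₂) : R × S) ∣ (y₁, y₂) ↔ x₁ ∣ y₁ ∧ x₂ ∣ y₂ :=
  ⟨fun ⟨c, hc⟩ ↦ ⟨⟨c.1, (Prod.ext_iff.1 hc).1⟩, ⟨c.2, (Prod.ext_iff.1 hc).2⟩⟩,
    fun ⟨⟨c₁, h₁⟩, ⟨c₂, h₂⟩⟩ ↦ ⟨(c₁, c₂), Prod.ext h₁ h₂⟩⟩

/-- An ordinal in `[ω, ω + k)` is `ω + m` with `m < k`. [folklore] -/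
private theorem exists_eq_omega0_add_of_lt {β : Ordinal.{u}} {k : ℕ} (hωβ : ω ≤ β) (hβ : β < ω + (k : Ordinal.{u})) :
    ∃ m : ℕ, m < k ∧ β = ω + (m : Ordinal.{u}) := by
  have h3 : ω + (β - ω) = β := Ordinal.add_sub_cancel_of_le hωβ
  have h4 : β - ω < (k : Ordinal.{u}) := by
    rw [← h3] at hβ
    exact (add_lt_add_iff_left _).1 hβ
  obtain ⟨m, hm⟩ := Ordinal.lt_omega0.1 (h4.trans (Ordinal.natCast_lt_omega0 k))
  refine ⟨m, ?_, ?_⟩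
  · rw [hm] at h4
    exact_mod_cast h4
  · rw [← h3, hm]

/-! ## §1 Both coordinates non-zero: `θ(x, y) = θ(x) + θ(y) − 1` -/

/-- **The «bad class» of an element**: if `x ∉ A_α` then some class mod `x` contains no element of `⋃_{β<α} A_β` (this is
just the definition of the stages, contraposed). [cite: Samuel1971, §4 «The transfinite construction» (p. 289);
Clark2015EuclideanOrderTypes, Thm. 19 (b)] -/
theorem exists_forall_not_dvd_sub_of_not_mem_samuelSet {x : R} {α : Ordinal.{u}} (hx : x ∉ samuelSet R α) :
    ∃ a : R, ∀ β < α, ∀ r ∈ samuelSet R β, ¬x ∣ a - r := by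
  by_contra h
  push Not at h
  exact hx (mem_samuelSet_of_forall h)

/-- **Upper bound, for all commutative `R`, `S`: `x ∈ A_{i+1}(R)`, `y ∈ A_{j+1}(S)`, `x, y ≠ 0 ⟹ (x, y) ∈ A_{i+j+1}(R × S)`**
(i.e. `θ(x, y) ≤ θ(x) + θ(y) − 1`): a class `(a₁, a₂)` contains `(r₁, r₂)`, `(x, r₂)`, `(r₁, y)` or `0` according as the
remainders `rᵢ` vanish (Samuel's «`(b₁, r₂)` … `q₁ − 1`»). [cite: Clark2015EuclideanOrderTypes, Thm. 22 (b) (upper bound,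
finite part); Samuel1971, Prop. 6 (p. 286)] -/
theorem Prod.mk_mem_samuelSet_natCast_add :
    ∀ (n i j : ℕ) (x : R) (y : S), i + j = n → x ≠ 0 → y ≠ 0 →
      x ∈ samuelSet R ((i + 1 : ℕ) : Ordinal.{u}) → y ∈ samuelSet S ((j + 1 : ℕ) : Ordinal.{u}) →
      ((x, y) : R × S) ∈ samuelSet (R × S) ((i + j + 1 : ℕ) : Ordinal.{u}) := by
  intro n
  induction n using Nat.strong_induction_on with
  | _ n ih =>
    intro i j x y hn hx hy hxi hyj
    refine mem_samuelSet_of_forall fun a ↦ ?_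
    obtain ⟨β₁, hβ₁, r₁, hr₁, hd₁⟩ := forall_of_mem_samuelSet hxi hx a.1
    obtain ⟨β₂, hβ₂, r₂, hr₂, hd₂⟩ := forall_of_mem_samuelSet hyj hy a.2
    rw [Nat.cast_succ] at hβ₁ hβ₂
    have hr₁' : r₁ ∈ samuelSet R (i : Ordinal.{u}) := samuelSet_mono (Order.lt_add_one_iff.1 hβ₁) hr₁
    have hr₂' : r₂ ∈ samuelSet S (j : Ordinal.{u}) := samuelSet_mono (Order.lt_add_one_iff.1 hβ₂) hr₂
    by_cases hr₁0 : r₁ = 0 <;> by_cases hr₂0 : r₂ = 0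
    · -- the class of `0`
      subst hr₁0; subst hr₂0
      refine ⟨0, by exact_mod_cast Nat.succ_pos _, 0, zero_mem_samuelSet 0, ?_⟩
      rw [_root_.sub_zero, ← Prod.mk.eta (p := a)]
      exact prodMk_dvd_iff.2 ⟨by simpa using hd₁, by simpa using hd₂⟩
    · -- `r₁ = 0 ≠ r₂`: the class of `(x, r₂)`; `j ≥ 1`
      subst hr₁0
      obtain ⟨j', rfl⟩ : ∃ j', j = j' + 1 := Nat.exists_eq_succ_of_ne_zero (by
        rintro rfl
        rw [Nat.cast_zero, samuelSet_zero] at hr₂'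
        exact hr₂0 hr₂')
      refine ⟨((i + j' + 1 : ℕ) : Ordinal.{u}), by exact_mod_cast (by omega), (x, r₂),
        ih (i + j') (by omega) i j' x r₂ rfl hx hr₂0 hxi hr₂', ?_⟩
      change ((x, y) : R × S) ∣ (a.1 - x, a.2 - r₂)
      exact prodMk_dvd_iff.2 ⟨(dvd_sub_self_right).2 (by simpa using hd₁), hd₂⟩
    · -- `r₂ = 0 ≠ r₁`: the class of `(r₁, y)`; `i ≥ 1`
      subst hr₂0
      obtain ⟨i', rfl⟩ : ∃ i', i = i' + 1 := Nat.exists_eq_succ_of_ne_zero (by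
        rintro rfl
        rw [Nat.cast_zero, samuelSet_zero] at hr₁'
        exact hr₁0 hr₁')
      refine ⟨((i' + j + 1 : ℕ) : Ordinal.{u}), by exact_mod_cast (by omega), (r₁, y),
        ih (i' + j) (by omega) i' j r₁ y rfl hr₁0 hy hr₁' hyj, ?_⟩
      change ((x, y) : R × S) ∣ (a.1 - r₁, a.2 - y)
      exact prodMk_dvd_iff.2 ⟨hd₁, (dvd_sub_self_right).2 (by simpa using hd₂)⟩
    · -- both non-zero: the class of `(r₁, r₂)`; `i, j ≥ 1`
      obtain ⟨i', rfl⟩ : ∃ i', i = i' + 1 := Nat.exists_eq_succ_of_ne_zero (by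
        rintro rfl
        rw [Nat.cast_zero, samuelSet_zero] at hr₁'
        exact hr₁0 hr₁')
      obtain ⟨j', rfl⟩ : ∃ j', j = j' + 1 := Nat.exists_eq_succ_of_ne_zero (by
        rintro rfl
        rw [Nat.cast_zero, samuelSet_zero] at hr₂'
        exact hr₂0 hr₂')
      refine ⟨((i' + j' + 1 : ℕ) : Ordinal.{u}), by exact_mod_cast (by omega), (r₁, r₂),
        ih (i' + j') (by omega) i' j' r₁ r₂ rfl hr₁0 hr₂0 hr₁' hr₂', ?_⟩
      change ((x, y) : R × S) ∣ (a.1 - r₁, a.2 - r₂)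
      exact prodMk_dvd_iff.2 ⟨hd₁, hd₂⟩

/-- `(x, 0)` (`x ≠ 0`) lies in NO finite stage of `R × S` when no finite stage exhausts `S` (the classes mod `(x, 0)` see all
of `S`) — Samuel's «`A_n′ → (ℤ × ℤ)/((1,0))` is surjective. This is impossible». [cite: Samuel1971, §3 Remark (2) (p. 287);
Clark2015EuclideanOrderTypes, proof of Thm. 22] -/
theorem Prod.mk_zero_not_mem_samuelSet_natCast (hS' : ∀ n : ℕ, ∃ c : S, c ∉ samuelSet S (n : Ordinal.{u})) {x : R}
    (hx : x ≠ 0) (n : ℕ) : ((x, 0) : R × S) ∉ samuelSet (R × S) (n : Ordinal.{u}) := by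
  intro h
  obtain ⟨c, hc⟩ := hS' n
  obtain ⟨β, hβ, hcβ⟩ := forall_exists_mem_samuelSet_lt_of_mk_zero_mem hx h c
  exact hc (samuelSet_mono hβ.le hcβ)

/-- **Lower bound: `x ∉ A_i(R)`, `y ∉ A_j(S) ⟹ (x, y) ∉ A_{i+j}(R × S)`** when no finite stage exhausts `S` (i.e.
`θ(x, y) ≥ θ(x) + θ(y) − 1`).  Test the class of `(a₁, 0)`, `a₁` a bad class of `x` at level `i`: a representative
`(r₁, r₂) ∈ A_m`, `m < i + j`, has `r₁ ∉ A_{i−1}`; `r₂ = 0` is impossible (`(r₁, 0)` lies in no finite stage), and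
`r₂ ≠ 0`, `y ∣ r₂` gives `r₂ ∉ A_j` (Prop. 4 (a)); induct.  (Clark obtains the bound from `ψ(y) = −φ(0,1) + φ(0,y)`.)
[cite: Clark2015EuclideanOrderTypes, Thm. 22 (b) and Thm. 27 (a); Samuel1971, §3 Remark (2) (p. 287)] -/
theorem Prod.mk_not_mem_samuelSet_natCast_add (hS' : ∀ n : ℕ, ∃ c : S, c ∉ samuelSet S (n : Ordinal.{u})) :
    ∀ (n i j : ℕ) (x : R) (y : S), i + j = n → x ∉ samuelSet R (i : Ordinal.{u}) → y ∉ samuelSet S (j : Ordinal.{u}) →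
      ((x, y) : R × S) ∉ samuelSet (R × S) ((i + j : ℕ) : Ordinal.{u}) := by
  intro n
  induction n using Nat.strong_induction_on with
  | _ n ih =>
    intro i j x y hn hxi hyj hmem
    -- the degenerate cases `i = 0`, `j = 0`: project
    rcases Nat.eq_zero_or_pos i with hi | hi
    · subst hi
      rw [Nat.zero_add] at hmem
      exact hyj (snd_mem_samuelSet hmem)
    rcases Nat.eq_zero_or_pos j with hj | hj
    · subst hj
      rw [Nat.add_zero] at hmem
      exact hxi (fst_mem_samuelSet hmem)
    obtain ⟨i', rfl⟩ : ∃ i', i = i' + 1 := Nat.exists_eq_succ_of_ne_zero hi.ne'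
    -- the bad class `a₁` of `x` at level `i' + 1`, tested against `(a₁, 0)`
    obtain ⟨a₁, ha₁⟩ := exists_forall_not_dvd_sub_of_not_mem_samuelSet hxi
    have hx0 : x ≠ 0 := fun h ↦ hxi (h ▸ zero_mem_samuelSet _)
    obtain ⟨γ, hγ, r, hr, hd⟩ := forall_of_mem_samuelSet hmem (by simp [hx0]) (a₁, 0)
    change ((x, y) : R × S) ∣ (a₁ - r.1, 0 - r.2) at hd
    obtain ⟨hd₁, hd₂⟩ := prodMk_dvd_iff.1 hd
    rw [_root_.zero_sub, dvd_neg] at hd₂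
    obtain ⟨m, rfl⟩ := Ordinal.lt_omega0.1 (hγ.trans (Ordinal.natCast_lt_omega0 _))
    have hm : m < i' + 1 + j := by exact_mod_cast hγ
    have hr1 : r.1 ∉ samuelSet R (i' : Ordinal.{u}) :=
      fun h ↦ ha₁ _ (by exact_mod_cast Nat.lt_succ_self i') _ h hd₁
    have hr10 : r.1 ≠ 0 := fun h ↦ hr1 (h ▸ zero_mem_samuelSet _)
    have hr20 : r.2 ≠ 0 := by
      intro h
      have hr0 : r = (r.1, 0) := Prod.ext rfl h
      rw [hr0] at hr
      exact Prod.mk_zero_not_mem_samuelSet_natCast hS' hr10 m hr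
    obtain ⟨c, hc⟩ := hd₂
    have hr2 : r.2 ∉ samuelSet S (j : Ordinal.{u}) := fun h ↦
      hyj (mem_samuelSet_of_mul_mem (by rw [← hc]; exact h) (by rw [← hc]; exact hr20))
    have key := ih (i' + j) (by omega) i' j r.1 r.2 rfl hr1 hr2
    exact key (by simpa only [Prod.mk.eta] using samuelSet_mono (by exact_mod_cast (by omega : m ≤ i' + j)) hr)

/-- A finite non-zero value `θ(x) = i + 1` pins `x` between stages: `x ∈ A_{i+1} ∖ A_i`. [cite: Samuel1971, §4 (4.3) (p. 289)] -/
theorem mem_and_not_mem_of_samuelRank_eq_natCast_succ {x : R} {i : ℕ}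
    (hx : samuelRank x = ((i + 1 : ℕ) : Ordinal.{u})) :
    x ∈ samuelSet R ((i + 1 : ℕ) : Ordinal.{u}) ∧ x ∉ samuelSet R (i : Ordinal.{u}) := by
  have hxe : ∃ α : Ordinal.{u}, x ∈ samuelSet R α :=
    exists_mem_samuelSet_of_samuelRank_ne_zero (by rw [hx]; exact_mod_cast Nat.succ_ne_zero i)
  obtain ⟨hm, hn⟩ := (samuelRank_eq_iff hxe).1 hx
  exact ⟨hm, hn _ (by exact_mod_cast Nat.lt_succ_self i)⟩

/-- **`θ(x, y) = θ(x) + θ(y) − 1` off the axes** for finite values `θ(x) = i + 1`, `θ(y) = j + 1` (no finite stage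
exhausting `S`): Lenstra's ∕ Clark's additivity `φ(x, y) = φ(x) + φ(y)` of the bottom Euclidean function in the finite
range. [cite: Clark2015EuclideanOrderTypes, Thm. 22 (b) and Thm. 27 (a); Samuel1971, §3 Remark (2) (p. 287)] -/
theorem Prod.samuelRank_mk_of_samuelRank_eq (hS' : ∀ n : ℕ, ∃ c : S, c ∉ samuelSet S (n : Ordinal.{u}))
    {x : R} {y : S} {i j : ℕ} (hx : samuelRank x = ((i + 1 : ℕ) : Ordinal.{u}))
    (hy : samuelRank y = ((j + 1 : ℕ) : Ordinal.{u})) :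
    samuelRank ((x, y) : R × S) = ((i + j + 1 : ℕ) : Ordinal.{u}) := by
  obtain ⟨hxm, hxi⟩ := mem_and_not_mem_of_samuelRank_eq_natCast_succ hx
  obtain ⟨hym, hyj⟩ := mem_and_not_mem_of_samuelRank_eq_natCast_succ hy
  have hx0 : x ≠ 0 := fun h ↦ hxi (h ▸ zero_mem_samuelSet _)
  have hy0 : y ≠ 0 := fun h ↦ hyj (h ▸ zero_mem_samuelSet _)
  have hmem := Prod.mk_mem_samuelSet_natCast_add _ i j x y rfl hx0 hy0 hxm hym
  refine (samuelRank_eq_iff ⟨_, hmem⟩).2 ⟨hmem, fun β hβ hβm ↦ ?_⟩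
  obtain ⟨m, rfl⟩ := Ordinal.lt_omega0.1 (hβ.trans (Ordinal.natCast_lt_omega0 _))
  have hm : m < i + j + 1 := by exact_mod_cast hβ
  exact Prod.mk_not_mem_samuelSet_natCast_add hS' _ i j x y rfl hxi hyj
    (samuelSet_mono (by exact_mod_cast (by omega : m ≤ i + j)) hβm)

/-! ## §2 On the axis: `θ(x, 0) = ω + (θ(x) − 1)` when `S` is small and unbounded -/

/-- Upper bound on the axis: `x ∈ A_{i+1}(R) ⟹ (x, 0) ∈ A_{ω+i}(R × S)` when the finite stages exhaust `S` — a class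
`(a₁, a₂)` with `a₂ ≠ 0` contains `(r₁, a₂)` or `(x, a₂)` (finite stage, §1), a class `(a₁, 0)` contains `(r₁, 0)` or `0`.
[cite: Clark2015EuclideanOrderTypes, Thm. 22 (b), Thm. 27 (a); Samuel1971, §3 Remark (2) (p. 287)] -/
theorem Prod.mk_zero_mem_samuelSet_omega0_add (hSfin : ∀ y : S, ∃ n : ℕ, y ∈ samuelSet S (n : Ordinal.{u})) :
    ∀ (i : ℕ) (x : R), x ∈ samuelSet R ((i + 1 : ℕ) : Ordinal.{u}) →
      ((x, 0) : R × S) ∈ samuelSet (R × S) (ω + (i : Ordinal.{u})) := by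
  intro i
  induction i using Nat.strong_induction_on with
  | _ i ih =>
    intro x hxi
    by_cases hx0 : x = 0
    · subst hx0
      rw [show (((0 : R), (0 : S)) : R × S) = 0 from rfl]
      exact zero_mem_samuelSet _
    have hωpos : (0 : Ordinal.{u}) < ω + (i : Ordinal.{u}) := Ordinal.omega0_pos.trans_le le_self_add
    refine mem_samuelSet_of_forall fun a ↦ ?_
    obtain ⟨β, hβ, r₁, hr₁, hd₁⟩ := forall_of_mem_samuelSet hxi hx0 a.1
    rw [Nat.cast_succ] at hβ
    obtain ⟨m, rfl⟩ := Ordinal.lt_omega0.1 (hβ.trans_le (Order.add_one_le_iff.2 (Ordinal.natCast_lt_omega0 i)))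
    have hmi : m ≤ i := by exact_mod_cast Order.lt_add_one_iff.1 hβ
    by_cases ha₂ : a.2 = 0
    · by_cases hr₁0 : r₁ = 0
      · -- the class of `0`
        subst hr₁0
        refine ⟨0, hωpos, 0, zero_mem_samuelSet 0, ?_⟩
        rw [_root_.sub_zero, ← Prod.mk.eta (p := a)]
        exact prodMk_dvd_iff.2 ⟨by simpa using hd₁, by simp [ha₂]⟩
      · -- the class of `(r₁, 0)`, `r₁ ∈ A_m`, `1 ≤ m ≤ i`
        obtain ⟨m', rfl⟩ : ∃ m', m = m' + 1 := Nat.exists_eq_succ_of_ne_zero (by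
          rintro rfl
          rw [Nat.cast_zero, samuelSet_zero] at hr₁
          exact hr₁0 hr₁)
        refine ⟨ω + (m' : Ordinal.{u}), (add_lt_add_iff_left _).2 (by exact_mod_cast (by omega)), (r₁, 0),
          ih m' (by omega) r₁ hr₁, ?_⟩
        change ((x, (0 : S)) : R × S) ∣ (a.1 - r₁, a.2 - 0)
        exact prodMk_dvd_iff.2 ⟨hd₁, by simp [ha₂]⟩
    · -- `a₂ ≠ 0`: a finite stage
      obtain ⟨n, hn⟩ := hSfin a.2
      obtain ⟨n', rfl⟩ : ∃ n', n = n' + 1 := Nat.exists_eq_succ_of_ne_zero (by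
        rintro rfl
        rw [Nat.cast_zero, samuelSet_zero] at hn
        exact ha₂ hn)
      by_cases hr₁0 : r₁ = 0
      · -- the class of `(x, a₂)` (Samuel's `q₁ − 1`)
        subst hr₁0
        refine ⟨_, (Ordinal.natCast_lt_omega0 (i + n' + 1)).trans_le le_self_add, (x, a.2),
          Prod.mk_mem_samuelSet_natCast_add _ i n' x a.2 rfl hx0 ha₂ hxi hn, ?_⟩
        change ((x, (0 : S)) : R × S) ∣ (a.1 - x, a.2 - a.2)
        exact prodMk_dvd_iff.2 ⟨(dvd_sub_self_right).2 (by simpa using hd₁), by simp⟩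
      · -- the class of `(r₁, a₂)`
        obtain ⟨m', rfl⟩ : ∃ m', m = m' + 1 := Nat.exists_eq_succ_of_ne_zero (by
          rintro rfl
          rw [Nat.cast_zero, samuelSet_zero] at hr₁
          exact hr₁0 hr₁)
        refine ⟨_, (Ordinal.natCast_lt_omega0 (m' + n' + 1)).trans_le le_self_add, (r₁, a.2),
          Prod.mk_mem_samuelSet_natCast_add _ m' n' r₁ a.2 rfl hr₁0 ha₂ hr₁ hn, ?_⟩
        change ((x, (0 : S)) : R × S) ∣ (a.1 - r₁, a.2 - a.2)
        exact prodMk_dvd_iff.2 ⟨hd₁, by simp⟩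

/-- Lower bound on the axis: `x ∉ A_{i+1}(R) ⟹ (x, 0) ∉ A_{ω+i}(R × S)` when no finite stage exhausts `S` (test the class
`(a₁, 0)` of a bad class `a₁`: its representatives are `(r₁, 0)`, `r₁ ∉ A_i`, which lie in no finite stage).
[cite: Clark2015EuclideanOrderTypes, Thm. 22 (b), Thm. 27 (a); Samuel1971, §3 Remark (2) (p. 287)] -/
theorem Prod.mk_zero_not_mem_samuelSet_omega0_add (hS' : ∀ n : ℕ, ∃ c : S, c ∉ samuelSet S (n : Ordinal.{u})) :
    ∀ (i : ℕ) (x : R), x ∉ samuelSet R ((i + 1 : ℕ) : Ordinal.{u}) →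
      ((x, 0) : R × S) ∉ samuelSet (R × S) (ω + (i : Ordinal.{u})) := by
  intro i
  induction i using Nat.strong_induction_on with
  | _ i ih =>
    intro x hxi hmem
    have hx0 : x ≠ 0 := fun h ↦ hxi (h ▸ zero_mem_samuelSet _)
    obtain ⟨a₁, ha₁⟩ := exists_forall_not_dvd_sub_of_not_mem_samuelSet hxi
    obtain ⟨γ, hγ, r, hr, hd⟩ := forall_of_mem_samuelSet hmem (by simp [hx0]) (a₁, 0)
    change ((x, (0 : S)) : R × S) ∣ (a₁ - r.1, 0 - r.2) at hd
    obtain ⟨hd₁, hd₂⟩ := prodMk_dvd_iff.1 hd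
    rw [zero_dvd_iff, _root_.zero_sub, neg_eq_zero] at hd₂
    have hr0 : r = (r.1, 0) := Prod.ext rfl hd₂
    rw [hr0] at hr
    have hr1 : r.1 ∉ samuelSet R (i : Ordinal.{u}) :=
      fun h ↦ ha₁ _ (by exact_mod_cast Nat.lt_succ_self i) _ h hd₁
    have hr10 : r.1 ≠ 0 := fun h ↦ hr1 (h ▸ zero_mem_samuelSet _)
    have hωγ : ω ≤ γ := by
      by_contra hlt
      obtain ⟨m, rfl⟩ := Ordinal.lt_omega0.1 (not_le.1 hlt)
      exact Prod.mk_zero_not_mem_samuelSet_natCast hS' hr10 m hr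
    obtain ⟨m, hmi, rfl⟩ := exists_eq_omega0_add_of_lt hωγ hγ
    obtain ⟨i', rfl⟩ : ∃ i', i = i' + 1 := Nat.exists_eq_succ_of_ne_zero (by omega)
    -- `r.1 ∉ A_{m+1}` since `m + 1 ≤ i' + 1 = i`
    have hr1' : r.1 ∉ samuelSet R ((m + 1 : ℕ) : Ordinal.{u}) :=
      fun h ↦ hr1 (samuelSet_mono (by exact_mod_cast (by omega : m + 1 ≤ i' + 1)) h)
    exact ih m (by omega) r.1 hr1' hr

/-- **`θ(x, 0) = ω + (θ(x) − 1)` on the axis** for `θ(x) = i + 1` finite, `S` small (finite stages exhaust it) and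
unbounded (no finite stage exhausts it): Clark's `φ_R(x, 0) = e(S) + φ(x) = ω + φ(x)`.
[cite: Clark2015EuclideanOrderTypes, Thm. 19 (b), Thm. 22 (b), Thm. 27 (a); Samuel1971, §3 Remark (2) (p. 287)] -/
theorem Prod.samuelRank_mk_zero_of_samuelRank_eq (hSfin : ∀ y : S, ∃ n : ℕ, y ∈ samuelSet S (n : Ordinal.{u}))
    (hS' : ∀ n : ℕ, ∃ c : S, c ∉ samuelSet S (n : Ordinal.{u})) {x : R} {i : ℕ}
    (hx : samuelRank x = ((i + 1 : ℕ) : Ordinal.{u})) :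
    samuelRank ((x, 0) : R × S) = ω + (i : Ordinal.{u}) := by
  obtain ⟨hxm, hxi⟩ := mem_and_not_mem_of_samuelRank_eq_natCast_succ hx
  have hx0 : x ≠ 0 := fun h ↦ hxi (h ▸ zero_mem_samuelSet _)
  have hxe : ∃ α : Ordinal.{u}, x ∈ samuelSet R α := ⟨_, hxm⟩
  have hmem := Prod.mk_zero_mem_samuelSet_omega0_add hSfin i x hxm
  refine (samuelRank_eq_iff ⟨_, hmem⟩).2 ⟨hmem, fun β hβ hβm ↦ ?_⟩
  rcases lt_or_ge β ω with hβω | hωβ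
  · obtain ⟨m, rfl⟩ := Ordinal.lt_omega0.1 hβω
    exact Prod.mk_zero_not_mem_samuelSet_natCast hS' hx0 m hβm
  · obtain ⟨m, hm, rfl⟩ := exists_eq_omega0_add_of_lt hωβ hβ
    have hxm1 : x ∉ samuelSet R ((m + 1 : ℕ) : Ordinal.{u}) :=
      ((samuelRank_eq_iff hxe).1 hx).2 _ (by exact_mod_cast (by omega : m + 1 < i + 1))
    exact Prod.mk_zero_not_mem_samuelSet_omega0_add hS' m x hxm1 hβm

/-- Symmetrically `θ(0, y) = ω + (θ(y) − 1)` for `R` small and unbounded. [cite: Clark2015EuclideanOrderTypes, Thm. 22 (b),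
Thm. 27 (a)] -/
theorem Prod.samuelRank_zero_mk_of_samuelRank_eq (hRfin : ∀ x : R, ∃ n : ℕ, x ∈ samuelSet R (n : Ordinal.{u}))
    (hR' : ∀ n : ℕ, ∃ c : R, c ∉ samuelSet R (n : Ordinal.{u}))
    (hSfin : ∀ y : S, ∃ n : ℕ, y ∈ samuelSet S (n : Ordinal.{u})) {y : S} {j : ℕ}
    (hy : samuelRank y = ((j + 1 : ℕ) : Ordinal.{u})) :
    samuelRank (((0 : R), y) : R × S) = ω + (j : Ordinal.{u}) := by
  have h : (RingEquiv.prodComm : S × R ≃+* R × S) (y, 0) = ((0 : R), y) := rfl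
  rw [← h, samuelRank_map_ringEquiv _ (Prod.forall_exists_mem_samuelSet (fun s ↦ let ⟨n, hn⟩ := hSfin s; ⟨_, hn⟩)
    (fun r ↦ let ⟨n, hn⟩ := hRfin r; ⟨_, hn⟩) _)]
  exact Prod.samuelRank_mk_zero_of_samuelRank_eq hRfin hR' hy

/-! ## §3 Both factors small and unbounded: `e(R × S) = ω + ω` -/

/-- A non-zero element of a small ring has a finite value `θ(x) = i + 1`. [cite: Clark2015EuclideanOrderTypes, §2.9 («small»)] -/
theorem exists_samuelRank_eq_natCast_succ {x : R} (hfin : ∃ n : ℕ, x ∈ samuelSet R (n : Ordinal.{u})) (hx : x ≠ 0) :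
    ∃ i : ℕ, samuelRank x = ((i + 1 : ℕ) : Ordinal.{u}) := by
  obtain ⟨n, hn⟩ := hfin
  have hle : samuelRank x ≤ (n : Ordinal.{u}) := samuelRank_le_of_mem hn
  obtain ⟨k, hk⟩ := Ordinal.lt_omega0.1 (hle.trans_lt (Ordinal.natCast_lt_omega0 n))
  have hk0 : k ≠ 0 := by
    rintro rfl
    exact (samuelRank_pos ⟨_, hn⟩ hx).ne' (by rw [hk, Nat.cast_zero])
  obtain ⟨i, rfl⟩ := Nat.exists_eq_succ_of_ne_zero hk0
  exact ⟨i, hk⟩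

/-- Every value of `θ` on `R × S` is `< ω + ω` (both factors small, `S` … and `R` unbounded for the axes).
[cite: Clark2015EuclideanOrderTypes, Thm. 27 (a)] -/
theorem Prod.samuelRank_lt_omega0_add_omega0_of_small
    (hRfin : ∀ x : R, ∃ n : ℕ, x ∈ samuelSet R (n : Ordinal.{u})) (hR' : ∀ n : ℕ, ∃ c : R, c ∉ samuelSet R (n : Ordinal.{u}))
    (hSfin : ∀ y : S, ∃ n : ℕ, y ∈ samuelSet S (n : Ordinal.{u})) (hS' : ∀ n : ℕ, ∃ c : S, c ∉ samuelSet S (n : Ordinal.{u}))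
    (z : R × S) : samuelRank z < ω + ω := by
  obtain ⟨x, y⟩ := z
  by_cases hx : x = 0 <;> by_cases hy : y = 0
  · subst hx; subst hy
    rw [show (((0 : R), (0 : S)) : R × S) = 0 from rfl, samuelRank_zero]
    exact Ordinal.omega0_pos.trans_le le_self_add
  · subst hx
    obtain ⟨j, hj⟩ := exists_samuelRank_eq_natCast_succ (hSfin y) hy
    rw [Prod.samuelRank_zero_mk_of_samuelRank_eq hRfin hR' hSfin hj]
    exact (add_lt_add_iff_left _).2 (Ordinal.natCast_lt_omega0 _)
  · subst hy
    obtain ⟨i, hi⟩ := exists_samuelRank_eq_natCast_succ (hRfin x) hx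
    rw [Prod.samuelRank_mk_zero_of_samuelRank_eq hSfin hS' hi]
    exact (add_lt_add_iff_left _).2 (Ordinal.natCast_lt_omega0 _)
  · obtain ⟨i, hi⟩ := exists_samuelRank_eq_natCast_succ (hRfin x) hx
    obtain ⟨j, hj⟩ := exists_samuelRank_eq_natCast_succ (hSfin y) hy
    rw [Prod.samuelRank_mk_of_samuelRank_eq hS' hi hj]
    exact (Ordinal.natCast_lt_omega0 _).trans_le le_self_add

/-- For every `n` there is `x ∈ R` with `θ(x, 0) = ω + i`, `n ≤ i` (`R` small and unbounded, `S` small and unbounded).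
[cite: Clark2015EuclideanOrderTypes, Thm. 27 (a)] -/
theorem Prod.exists_samuelRank_mk_zero_eq
    (hRfin : ∀ x : R, ∃ n : ℕ, x ∈ samuelSet R (n : Ordinal.{u})) (hR' : ∀ n : ℕ, ∃ c : R, c ∉ samuelSet R (n : Ordinal.{u}))
    (hSfin : ∀ y : S, ∃ n : ℕ, y ∈ samuelSet S (n : Ordinal.{u})) (hS' : ∀ n : ℕ, ∃ c : S, c ∉ samuelSet S (n : Ordinal.{u}))
    (n : ℕ) : ∃ (x : R) (i : ℕ), n ≤ i ∧ samuelRank ((x, 0) : R × S) = ω + (i : Ordinal.{u}) := by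
  obtain ⟨x, hxn⟩ := hR' n
  have hx0 : x ≠ 0 := fun h ↦ hxn (h ▸ zero_mem_samuelSet _)
  obtain ⟨i, hi⟩ := exists_samuelRank_eq_natCast_succ (hRfin x) hx0
  refine ⟨x, i, ?_, Prod.samuelRank_mk_zero_of_samuelRank_eq hSfin hS' hi⟩
  by_contra hlt
  exact hxn (samuelSet_mono (by exact_mod_cast (by omega : i + 1 ≤ n)) (mem_and_not_mem_of_samuelRank_eq_natCast_succ hi).1)

/-- **The transfinite construction of `R × S` exhausts it exactly at stage `ω + ω`: `A_α(R × S) = R × S ⟺ ω + ω ≤ α`**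
(both factors small and unbounded). [cite: Clark2015EuclideanOrderTypes, Thm. 27 (a); Samuel1971, §3 Remark (2)
(pp. 286–287)] -/
theorem Prod.samuelSet_eq_univ_iff_of_small
    (hRfin : ∀ x : R, ∃ n : ℕ, x ∈ samuelSet R (n : Ordinal.{u})) (hR' : ∀ n : ℕ, ∃ c : R, c ∉ samuelSet R (n : Ordinal.{u}))
    (hSfin : ∀ y : S, ∃ n : ℕ, y ∈ samuelSet S (n : Ordinal.{u})) (hS' : ∀ n : ℕ, ∃ c : S, c ∉ samuelSet S (n : Ordinal.{u}))
    {α : Ordinal.{u}} : samuelSet (R × S) α = Set.univ ↔ ω + ω ≤ α := by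
  constructor
  · intro h
    refine (Ordinal.add_le_iff_of_isSuccLimit Ordinal.isSuccLimit_omega0).2 fun d hd ↦ ?_
    obtain ⟨n, rfl⟩ := Ordinal.lt_omega0.1 hd
    obtain ⟨x, i, hni, hxi⟩ := Prod.exists_samuelRank_mk_zero_eq hRfin hR' hSfin hS' n
    have hmem : ((x, 0) : R × S) ∈ samuelSet (R × S) α := Set.eq_univ_iff_forall.1 h _
    have := samuelRank_le_of_mem hmem
    rw [hxi] at this
    exact le_trans ((add_le_add_iff_left _).2 (by exact_mod_cast hni)) this
  · intro h
    have hRS := Prod.forall_exists_mem_samuelSet (fun r ↦ let ⟨n, hn⟩ := hRfin r; ⟨(n : Ordinal.{u}), hn⟩)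
      (fun s ↦ let ⟨n, hn⟩ := hSfin s; ⟨(n : Ordinal.{u}), hn⟩)
    exact Set.eq_univ_of_forall fun z ↦ samuelSet_mono
      ((Prod.samuelRank_lt_omega0_add_omega0_of_small hRfin hR' hSfin hS' z).le.trans h)
      (mem_samuelSet_samuelRank (hRS z))

/-- `ω + a − 1 = ω + a`. [folklore] -/
private theorem omega0_add_sub_one (a : Ordinal.{u}) : ω + a - 1 = ω + a :=
  Ordinal.sub_eq_of_add_eq (by rw [← add_assoc, Ordinal.one_add_omega0])

/-- **Clark's Theorem 27 (a) for two factors: `e(R × S) = ω + ω`** («`e(R) = rω + ℓ(A)`», `r = 2`, `A = 0`) for small and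
unbounded `R`, `S` — with `e(R) = e(S) = ω` both bounds of the Product Theorem coincide (`ω + ω = ω ⊕ ω`).
[cite: Clark2015EuclideanOrderTypes, Thm. 27 (a), Thm. 22 (b)] -/
theorem Prod.iSup_samuelRank_eq_of_small
    (hRfin : ∀ x : R, ∃ n : ℕ, x ∈ samuelSet R (n : Ordinal.{u})) (hR' : ∀ n : ℕ, ∃ c : R, c ∉ samuelSet R (n : Ordinal.{u}))
    (hSfin : ∀ y : S, ∃ n : ℕ, y ∈ samuelSet S (n : Ordinal.{u})) (hS' : ∀ n : ℕ, ∃ c : S, c ∉ samuelSet S (n : Ordinal.{u})) :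
    (⨆ z : R × S, (samuelRank z - 1 + 1)) = ω + ω := by
  refine le_antisymm (Ordinal.iSup_le fun z ↦ ?_) ?_
  · exact (add_le_add (Ordinal.sub_le_self _ _) le_rfl).trans
      (Order.add_one_le_iff.2 (Prod.samuelRank_lt_omega0_add_omega0_of_small hRfin hR' hSfin hS' z))
  · refine (Ordinal.add_le_iff_of_isSuccLimit Ordinal.isSuccLimit_omega0).2 fun d hd ↦ ?_
    obtain ⟨n, rfl⟩ := Ordinal.lt_omega0.1 hd
    obtain ⟨x, i, hni, hxi⟩ := Prod.exists_samuelRank_mk_zero_eq hRfin hR' hSfin hS' n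
    calc ω + (n : Ordinal.{u}) ≤ ω + (i : Ordinal.{u}) := (add_le_add_iff_left _).2 (by exact_mod_cast hni)
      _ ≤ ω + (i : Ordinal.{u}) + 1 := le_self_add
      _ = samuelRank ((x, 0) : R × S) - 1 + 1 := by rw [hxi, omega0_add_sub_one]
      _ ≤ ⨆ z : R × S, (samuelRank z - 1 + 1) := Ordinal.le_iSup (fun z : R × S ↦ samuelRank z - 1 + 1) _

/-- **Every algorithm on `R × S` takes values of order type `≥ ω + ω`** (both factors small and unbounded): for
`φ : R × S → W`, `W` well ordered, `ω + ω ≤ type W` — Samuel's «transfinite valued algorithms … unavoidable», for all such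
products. [cite: Samuel1971, §3 Remark (2) (p. 286); Clark2015EuclideanOrderTypes, Thm. 27 (a)] -/
theorem Prod.omega0_add_omega0_le_type_of_small
    (hRfin : ∀ x : R, ∃ n : ℕ, x ∈ samuelSet R (n : Ordinal.{u})) (hR' : ∀ n : ℕ, ∃ c : R, c ∉ samuelSet R (n : Ordinal.{u}))
    (hSfin : ∀ y : S, ∃ n : ℕ, y ∈ samuelSet S (n : Ordinal.{u})) (hS' : ∀ n : ℕ, ∃ c : S, c ∉ samuelSet S (n : Ordinal.{u}))
    {W : Type u} [LinearOrder W] [WellFoundedLT W] (φ : R × S → W)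
    (hφ : ∀ a b : R × S, b ≠ 0 → ∃ q r : R × S, a = b * q + r ∧ φ r < φ b) :
    ω + ω ≤ Ordinal.type (α := W) (· < ·) := by
  refine (Ordinal.add_le_iff_of_isSuccLimit Ordinal.isSuccLimit_omega0).2 fun d hd ↦ ?_
  obtain ⟨n, rfl⟩ := Ordinal.lt_omega0.1 hd
  obtain ⟨x, i, hni, hxi⟩ := Prod.exists_samuelRank_mk_zero_eq hRfin hR' hSfin hS' n
  have h := samuelRank_le_typein φ hφ ((x, 0) : R × S)
  rw [hxi] at h
  exact (((add_le_add_iff_left _).2 (by exact_mod_cast hni)).trans (h.trans (Ordinal.typein_lt_type _ _).le))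

end Product

/-! ## §4 Euclidean domains with finite residue rings (Prop. 28): `e(R × S) = ω + ω` -/

section FiniteQuotients

variable {R : Type u} [CommRing R]

/-- A ring with finite residue rings exhausted by its construction is small: its finite stages exhaust it (Prop. 15 ∕
Prop. 28). [cite: Clark2015EuclideanOrderTypes, Prop. 28; Samuel1971, Prop. 15 (p. 294)] -/
theorem forall_exists_mem_samuelSet_natCast_of_finite_quotients
    (hfin : ∀ b : R, b ≠ 0 → Finite (R ⧸ Ideal.span {b})) (h : ∀ x : R, ∃ α : Ordinal.{u}, x ∈ samuelSet R α) :
    ∀ x : R, ∃ n : ℕ, x ∈ samuelSet R (n : Ordinal.{u}) := fun x ↦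
  Set.mem_iUnion.1 (Set.eq_univ_iff_forall.1 (iUnion_samuelSet_natCast_eq_univ_of_finite_quotients hfin h) x)

/-- A ring of Euclidean order type `≥ ω` is unbounded: no finite stage exhausts it. [cite: Clark2015EuclideanOrderTypes,
§2.9 and Thm. 25 (c)] -/
theorem exists_not_mem_samuelSet_natCast_of_omega0_le (hω : ω ≤ ⨆ z : R, (samuelRank z - 1 + 1)) (n : ℕ) :
    ∃ c : R, c ∉ samuelSet R (n : Ordinal.{u}) := by
  by_contra h
  push Not at h
  have hle : (⨆ z : R, (samuelRank z - 1 + 1)) ≤ (n : Ordinal.{u}) + 1 :=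
    Ordinal.iSup_le fun z ↦ (add_le_add (Ordinal.sub_le_self _ _) le_rfl).trans
      (add_le_add (samuelRank_le_of_mem (h z)) le_rfl)
  have : ω ≤ (n : Ordinal.{u}) + 1 := hω.trans hle
  exact not_lt.2 this (by exact_mod_cast Ordinal.natCast_lt_omega0 (n + 1))

/-- **`e(R × S) = ω + ω` for two Euclidean domains, not fields, with finite residue rings** (Prop. 28: they are small;
Thm. 27 (a) with `r = 2`): `ℤ × ℤ`, `ℤ × ℤ[i]`, `𝔽_q[X] × ℤ`, …. [cite: Clark2015EuclideanOrderTypes, Prop. 28 and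
Thm. 27 (a); Samuel1971, Prop. 15 (p. 294) and §3 Remark (2) (p. 286)] -/
theorem iSup_samuelRank_prod_eq_of_finite_quotients {R S : Type u} [EuclideanDomain R] [EuclideanDomain S]
    (hRq : ∀ b : R, b ≠ 0 → Finite (R ⧸ Ideal.span {b})) (hSq : ∀ b : S, b ≠ 0 → Finite (S ⧸ Ideal.span {b}))
    (hR : ∃ x : R, x ≠ 0 ∧ ¬IsUnit x) (hS : ∃ y : S, y ≠ 0 ∧ ¬IsUnit y) :
    (⨆ z : R × S, (samuelRank z - 1 + 1)) = ω + ω :=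
  Prod.iSup_samuelRank_eq_of_small
    (forall_exists_mem_samuelSet_natCast_of_finite_quotients hRq forall_exists_mem_samuelSet_of_euclideanDomain)
    (exists_not_mem_samuelSet_natCast_of_omega0_le (omega0_le_iSup_samuelRank_of_euclideanDomain hR))
    (forall_exists_mem_samuelSet_natCast_of_finite_quotients hSq forall_exists_mem_samuelSet_of_euclideanDomain)
    (exists_not_mem_samuelSet_natCast_of_omega0_le (omega0_le_iSup_samuelRank_of_euclideanDomain hS))

/-- … and their product is exhausted exactly at stage `ω + ω`. [cite: Clark2015EuclideanOrderTypes, Prop. 28 and Thm. 27 (a)] -/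
theorem samuelSet_prod_eq_univ_iff_of_finite_quotients {R S : Type u} [EuclideanDomain R] [EuclideanDomain S]
    (hRq : ∀ b : R, b ≠ 0 → Finite (R ⧸ Ideal.span {b})) (hSq : ∀ b : S, b ≠ 0 → Finite (S ⧸ Ideal.span {b}))
    (hR : ∃ x : R, x ≠ 0 ∧ ¬IsUnit x) (hS : ∃ y : S, y ≠ 0 ∧ ¬IsUnit y) {α : Ordinal.{u}} :
    samuelSet (R × S) α = Set.univ ↔ ω + ω ≤ α :=
  Prod.samuelSet_eq_univ_iff_of_small
    (forall_exists_mem_samuelSet_natCast_of_finite_quotients hRq forall_exists_mem_samuelSet_of_euclideanDomain)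
    (exists_not_mem_samuelSet_natCast_of_omega0_le (omega0_le_iSup_samuelRank_of_euclideanDomain hR))
    (forall_exists_mem_samuelSet_natCast_of_finite_quotients hSq forall_exists_mem_samuelSet_of_euclideanDomain)
    (exists_not_mem_samuelSet_natCast_of_omega0_le (omega0_le_iSup_samuelRank_of_euclideanDomain hS))

/-- … and every algorithm on their product needs a value set of order type `≥ ω + ω` — no ordinary Euclidean function,
none with values in `ω + n`. [cite: Samuel1971, §3 Remark (2) (p. 286); Clark2015EuclideanOrderTypes, Prop. 28, Thm. 27 (a)] -/
theorem omega0_add_omega0_le_type_prod_of_finite_quotients {R S : Type u} [EuclideanDomain R] [EuclideanDomain S]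
    (hRq : ∀ b : R, b ≠ 0 → Finite (R ⧸ Ideal.span {b})) (hSq : ∀ b : S, b ≠ 0 → Finite (S ⧸ Ideal.span {b}))
    (hR : ∃ x : R, x ≠ 0 ∧ ¬IsUnit x) (hS : ∃ y : S, y ≠ 0 ∧ ¬IsUnit y)
    {W : Type u} [LinearOrder W] [WellFoundedLT W] (φ : R × S → W)
    (hφ : ∀ a b : R × S, b ≠ 0 → ∃ q r : R × S, a = b * q + r ∧ φ r < φ b) :
    ω + ω ≤ Ordinal.type (α := W) (· < ·) :=
  Prod.omega0_add_omega0_le_type_of_small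
    (forall_exists_mem_samuelSet_natCast_of_finite_quotients hRq forall_exists_mem_samuelSet_of_euclideanDomain)
    (exists_not_mem_samuelSet_natCast_of_omega0_le (omega0_le_iSup_samuelRank_of_euclideanDomain hR))
    (forall_exists_mem_samuelSet_natCast_of_finite_quotients hSq forall_exists_mem_samuelSet_of_euclideanDomain)
    (exists_not_mem_samuelSet_natCast_of_omega0_le (omega0_le_iSup_samuelRank_of_euclideanDomain hS)) φ hφ

end FiniteQuotients

end Literature.Algebra.EuclideanDomain
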